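import Summits.QuantumFields.YangMills.Theorems.BalabanUVNodesN19TargetClassWeightsTwoRunKeyed

/-!
# BalabanUVNodes ∕ N20 (NE7b) — the `hedge`-JOINT COMPANION of the keyed relative-weight socket, module 1 of 2 (generic bad class): N19's core edge
# `NE7.Core` on the GOOD keyed classes `T K ∖ Bad K t` of n19-d's σ-packed two-run keyed data, DISPLAYED AS A TERMWISE SANDWICH on run A's (2.18)
# sequences against run B's block-down fibres — loss-free (an `iff`), for ANY bad key class `Bad` (the binder shared with `h20` ∕ `h21`)

Cell `pub-ymgap` (HUMAN RULING D-0062 Track A; D-0149 width push, director-ym №197), seat `pub-ymgap-dag-n20-w3` (WIDTH SEAT 3 of 3 on NODE n20 = NE7b) gen 0;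
W-SEAT-START-LIST v3 §2 n20 ITEM 3 as RE-POINTED by plan g77 (pub-ymgap INBOX l.24047): «the `hedge`-JOINT companion of w1 — at the same keyed data, the
displayed per-run CORE-EDGE domination on `T K ∖ Bad K t` that makes w1's `RelWeightBound` non-junk».  Filed `--kind proof --supports stmt-QuantumFields-20544
--as helper` (K3⁷ `SpineGivenEndpointR13SepCoPH`); COUNT-NEUTRAL.  [III] = [Balaban1988Convergent], [LF-I] = [Balaban1989LargeFieldI], [LF-II] = [Balaban1989LargeFieldII].

WHY THIS FILE.  At n19-d's keyed class-weight face B (`Thm/BalabanUVNodesN19TargetClassWeightsTwoRunKeyed` :169, p571597) the node-U5 road consumes FOUR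
displayed estimates over ONE σ-packed key type `Σ K, SiteSeqKey F (K₀ + K)` with class set `univ.image (kA K) ∪ univ.image (kB K)`: N20's `h20 : RelWeightBound …
Bad W`, N21's `h21`, U4′'s `hlt` and N19's core edge `hedge : ∃ δ, NE7.Core l₀ vol T Bad (A − shA) (B − shB) δ ∧ Summable δ` — and the bad key class `Bad` is ONE
FREE BINDER shared by `h20` and `hedge` (dag-n20-d LANE WORD l.24011: `RelWeightBound` alone is junk-inhabited by `Bad := ∅, W := 0`; its content is only JOINT
with `hedge` on the complement `T K ∖ Bad K t`).  n20-w1's socket (`Thm/…N20KeyedRelWeightSocket`, INTENT l.24081) says what `h20` asks of the two runs' TERMS for a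
given `Bad`; THIS file says what `hedge` asks of them for the SAME `Bad`:
* §1 (abstract keyed two-source data: a key type `κ`, finite source types `σA K` ∕ `σB K`, key maps `kA K` INJECTIVE and `kB K` with `range kB ⊆ range kA`
  — every run-B class has a run-A partner —, term weights `a` ∕ `b`, shells `shA` ∕ `shB`): the JOINT GUARD `(1 − W K)·Σ_T A ≤ Σ_{T∖Bad} A` (both runs) that a
  `RelWeightBound` leaves to the good class, its OBSTRUCTION SKELETON (`one_sub_le_weight_of_good_share_le`: a good class carrying at most the share `ε` forces
  `W K ≥ 1 − ε`; `tendsto_weight_zero_of_relWeightBound`: the weights tend to `0`), and ★ `core_keyed_iff_termwise` — `NE7.Core` on the keyed fibre sums IS, loss-free, the statement: for every `K`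
  ONE constant `c`, and for every `|t| ≤ l₀` and every run-A source term `s` whose key is NOT bad, the two-sided sandwich
  `e^{c − vol·δ K}·(a K t s − shA K t (kA K s)) ≤ (Σ_{s' : kB K s' = kA K s} b K t s') − shB K t (kA K s) ≤ e^{c + vol·δ K}·(a K t s − shA K t (kA K s))`
  (run A's keyed class is ONE term, run B's is a FIBRE); `coreEdge_keyed_of_termwise` adds `Summable δ` and delivers the `hedge` ∃-shape;
* §2 (node U5d's σ-packed two-run site keys `kA K s := ⟨K, twoRunKeyA … s⟩`, `kB K s' := ⟨K, twoRunKeyB … s'⟩` under the displayed flow hypothesis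
  `hR : ∀ K, RAgree F ν (gA K) (gB K) (K₀ + K)` of `Node00/TwoRunSiteTransport` — option (c); B §1 shows (b) and (c) give the same term data on run-A keys):
  ★★ `core_twoRunKeyed_iff_termwise` — run B's keyed fibre over `kA s` is the `truncSeq`-FIBRE `{s' : truncSeq s' = s}` (B §1
  `sum_filter_sigma_twoRunKeyB_keyA_eq_sum_filter_truncSeq`), so `hedge`'s core IS the termwise sandwich of run A's (2.18) term `s` at cutoff `K₀ + K`
  against the partial sum of run B's (2.18) terms at cutoff `K₀ + K + 1` blocking down to `s` (node U5d's partial summation, [King1986] (3.10)), on the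
  run-A sequences whose key is not in `Bad K t`; ★★ `coreEdge_twoRunKeyed_of_termwise` concludes B :169's `hedge` binder VERBATIM (weights generic, so it
  instantiates at F3's `classWeightOfDatum₉ …` of B §2 by `exact`); `core_twoRunKeyed_bad_empty_iff_termwise` — the DEGENERATE split `Bad := ∅` (the tree's
  `relWeightBound_empty` instance of `h20`): the core edge is then the termwise sandwich on EVERY run-A sequence, old large fields included (NE7 proper, no NE7b).
LOCATED (this seat, pub-ymgap bus l.24338 + precision, for the (α) reading): WITHIN one (2.18) sequence the chain is ANTITONE (`Chain21.Λ_antitone`), so a bad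
class of the form «`Λ_j ≠ T_η` for some `j ≤ jcut K`» (dag-n20-d's `KeyOldLargeField`) reads «`Λ_{jcut K} ≠ T_η`»; WHAT it records depends on the datum: (ρ1) if the
record's step-to-step index keeps every large-field region ever CREATED ([III] (2.18) as printed; 𝐑 of record acting on the last region only ∕ as the identity off the
represented tower), the good class `{Λ_{jcut K} = T_η} ⊆ {Λ_1 = T_η}` («no finest-level large field anywhere») has, by the volume count `L^{4(K₀+K)}` blocks against the
poly-log suppression `e^{−c·p₀(g_1)²}`, `p₀(g)² = A₀²(log g⁻²)^{2p₀}` (`Setup.p0Profile`), a share of either run's mass NOT bounded below as `K → ∞`, and a `RelWeightBound`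
with `Summable W` at such a class is not to be expected for Bałaban's weights; (ρ2) if 𝐑 of record REMOVES renormalised components from the old entries ([IV] (0.3)
p.176 `Z ↦ Z″ = Z ∖ Z′`; [LF-II] (1.70)–(1.72)), the class reads «old AND pending» as NE7b wants and the count is beaten by the renewal arithmetic (`T4WeightBudget` §3).
The record's DESIGN is (ρ2) — def-R's `Node00/RStepRepr218` re-indexes each 𝐑-step by the selector `a ↦ a″` and `Node00/LargeFieldTowerOfRecord.PpSelOfRecord`
(= `θ.ppSel`, residual data) has the intended meaning «the term with `Z′` declared small» —, (ρ1) arising only under a JUNK pin of `θ.ppSel` (identity); the count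
is then the CONSTRAINT that the pinned selector be history-rewriting (remove `Z′` from every entry `Λ_j`, `j ≥ j(Z′)`).  The generic `Bad` of THIS file (and its
`Bad := ∅` face) is the form that survives either pin.
The (α)-reading edition — `Bad K t := badKeysSigma F (T K) jcut` of dag-n20-d's `Node00/TwoRunSitePersistence` (INTENT-2 l.24056), under which «key not bad»
reads «`s.Λ_j = T_η` for all `1 ≤ j ≤ jcut K`» (the history is SMALL-FIELD up to the cut level), and the composition with B §2's road at ONE bad class — is
module 2 `Thm/BalabanUVNodesN20CoreEdgeAtPersistentKeys` (imports this file + that definition module; one declarer of the predicate = n20-d, consumed BY NAME).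

(α) READING (NC-NE7b-α UNRULED, chair ASK-1): this file fixes NO reading — `Bad` is B's free binder throughout, exactly as in n20-w1's socket, so that
n20-d's key-level persistence predicate (`KeyOldLargeField (jcut K)`: an OLD large-field region `Λ_j ≠ T_η` at some `1 ≤ j ≤ jcut K`, [LF-II] (1.80) p.384)
plugs in by substitution for `bad_left` ∕ `bad_right` ∕ `hedge` at once.

HONEST FRAMING.  Count-neutral kernel bookkeeping (finite sums, Mathlib + tree shapes BY NAME; B §1's faces and `Spine/NE7/Targets`' `NE7.Core` consumed,
nothing re-typed; `T4HybridMatching` §3's ONE-map partial summation `fiberSum` ∕ `HybridSandwich.of_fibers` is the un-keyed ancestor — cited, not used: here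
the class set carries TWO heterogeneous `K`-dependent source families).  It proves NO estimate: the displayed termwise sandwich for Bałaban's class weights
IS N19's NE7 core content (route H1L, `Spine/NE7/Targets` §3) jointly cut with N20's bad class — NOT PRINTED for `d = 4` ([LF-II] p.356 defers even the
one-run analysis of loop observables; [King1986] (3.10)–(3.13) pp.656–657 is the abelian `d = 2,3` template), NOT proved, NAMED OPEN; A6 (№189): LOCATED —
no Bałaban family inhabits it today, but every ★ is an `iff`, so the face is an equivalence and not vacuous as a statement.  NE7 ∕ NE7b NOT PRINTED ∕ NOT
PROVED; (α)-instance 0∕1; N19 ∕ N20 ∕ N21 ∕ N27 NOT discharged; K3⁷ NOT closed; counts unmoved (typed 28∕28 · discharged 5∕27); no count claim.  One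
finite `𝕋⁴_{L^K}` programme at fixed `ε = L^{−K}` along two consecutive cutoffs, Bałaban AS PRINTED; the YM mass gap (Clay) is NOT proved by any of this —
R4 closes the conditional finite-𝕋⁴ rung `BalabanLadder.UV` only; NOT ℝ⁴, NOT OS, NOT a mass gap.  No `instance`, no `notation`, no `def`, no `sorry`.
Sources (bookkeeping): [III] (2.1) p.254, (2.5) p.255, (2.18) p.257; [LF-I] (0.2)–(0.4) p.176; [LF-II] Thm 1 + (0.1) pp.355–356, (1.80) p.384; [King1986]
(3.10) p.656; [Balaban1985UV3] (6) p.257.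
-/

noncomputable section

namespace Summit.QuantumFields.YangMills.BalabanUVNodes.N20CoreEdgeTwoRunKeyed

open MeasureTheory Literature.MathematicalPhysics.QuantumFieldTheory.Balaban1983to89 Literature.MathematicalPhysics.QuantumFieldTheory.Balaban1983to89.Node00
open scoped BigOperators Matrix.Norms.L2Operator
open T4Continuum B14.Eq218Concrete Summit.QuantumFields.BalabanUV.T4Continuum.Spine
open T4WeightBudget (RelWeightBound)
open T4IndicatorShell (ShellWeightBound)
open T4CauchySum (MatchingModConstants)
open Summit.QuantumFields.YangMills.BalabanUVNodes.N19TargetClassWeightsTwoRunKeyed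
  (sigma_twoRunKeyA_injective sum_filter_sigma_twoRunKeyB_keyA_eq_sum_filter_truncSeq matching_scheme_of_coreEdge_twoRunKeyed_liveRepin₁₃)

/-! ## §1 ABSTRACT KEYED TWO-SOURCE CORES: the joint guard, and `NE7.Core` on keyed fibre sums ⟺ a termwise sandwich on the good source terms -/

section Guard

variable {ι : Type*} [DecidableEq ι] {l₀ : ℝ} {T : ℕ → Finset ι} {A B : ℕ → ℝ → ι → ℝ} {Bad : ℕ → ℝ → Finset ι} {W : ℕ → ℝ}

/-- **THE JOINT GUARD, run A**: under N20's `RelWeightBound … Bad W` the GOOD class `T K ∖ Bad K t` carries at least the fraction `1 − W K` (`> 0`) of run A's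
total weight — so the core edge asked on it (`NE7.Core`, this file) is asked on a class of positive mass whenever the total is positive: `h20` and `hedge` with
ONE `Bad` are jointly contentful, neither alone.  (`Finset.sum_sdiff` + `bad_left`; no sign hypothesis on `A`.) [cite: King1986, (3.10)–(3.11) p.656 (bookkeeping)] -/
theorem sum_sdiff_bad_ge_of_relWeightBound_left (hW : RelWeightBound l₀ T A B Bad W) (K : ℕ) {t : ℝ} (ht : |t| ≤ l₀) :
    (1 - W K) * ∑ τ ∈ T K, A K t τ ≤ ∑ τ ∈ T K \ Bad K t, A K t τ := by
  have hsplit := Finset.sum_sdiff (f := A K t) (hW.bad_subset K t ht)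
  have hbad := hW.bad_left K t ht
  rw [one_sub_mul]
  linarith

/-- **THE JOINT GUARD, run B** (same, with `bad_right`). [cite: King1986, (3.10)–(3.11) p.656 (bookkeeping)] -/
theorem sum_sdiff_bad_ge_of_relWeightBound_right (hW : RelWeightBound l₀ T A B Bad W) (K : ℕ) {t : ℝ} (ht : |t| ≤ l₀) :
    (1 - W K) * ∑ τ ∈ T K, B K t τ ≤ ∑ τ ∈ T K \ Bad K t, B K t τ := by
  have hsplit := Finset.sum_sdiff (f := B K t) (hW.bad_subset K t ht)
  have hbad := hW.bad_right K t ht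
  rw [one_sub_mul]
  linarith

/-- … hence, if run A's total weight is positive and its term weights on `T K` are nonnegative, the good class is NON-EMPTY (and `W K < 1` is `RelWeightBound.lt_one`).
[cite: King1986, (3.10)–(3.11) p.656 (bookkeeping)] -/
theorem sdiff_bad_nonempty_of_relWeightBound (hW : RelWeightBound l₀ T A B Bad W) (K : ℕ) {t : ℝ} (ht : |t| ≤ l₀)
    (hpos : 0 < ∑ τ ∈ T K, A K t τ) : (T K \ Bad K t).Nonempty := by
  have hgood : 0 < ∑ τ ∈ T K \ Bad K t, A K t τ :=
    lt_of_lt_of_le (mul_pos (sub_pos.2 (hW.lt_one K)) hpos) (sum_sdiff_bad_ge_of_relWeightBound_left hW K ht)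
  by_contra h
  rw [Finset.not_nonempty_iff_eq_empty] at h
  rw [h, Finset.sum_empty] at hgood
  exact lt_irrefl _ hgood

/-- **THE OBSTRUCTION SKELETON** (kernel form of this seat's located volume count): if at some `(K, t)` the good class carries at most the share `ε` of run A's
(positive) total, then `W K ≥ 1 − ε` — so a bad class whose complement is asymptotically weightless admits no `RelWeightBound` with `W K → 0`, in particular none
with `Summable W` (`Summable.tendsto_atTop_zero`).  [cite: King1986, (3.10)–(3.11) p.656 (bookkeeping)] -/
theorem one_sub_le_weight_of_good_share_le (hW : RelWeightBound l₀ T A B Bad W) (K : ℕ) {t : ℝ} (ht : |t| ≤ l₀) {ε : ℝ}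
    (hpos : 0 < ∑ τ ∈ T K, A K t τ) (hshare : ∑ τ ∈ T K \ Bad K t, A K t τ ≤ ε * ∑ τ ∈ T K, A K t τ) : 1 - ε ≤ W K := by
  have h := (sum_sdiff_bad_ge_of_relWeightBound_left hW K ht).trans hshare
  by_contra hlt
  have hlt' : W K < 1 - ε := lt_of_not_ge hlt
  have : ε * ∑ τ ∈ T K, A K t τ < (1 - W K) * ∑ τ ∈ T K, A K t τ := mul_lt_mul_of_pos_right (by linarith) hpos
  linarith

omit [DecidableEq ι] in
/-- … and the weights of a `RelWeightBound` tend to `0` (they are summable), so the good class's share of run A's mass tends to `1` along any `(K, t_K)` with positive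
totals: `1 − W K ≤ share K` with `W K → 0`. [cite: King1986, (3.10)–(3.11) p.656 (bookkeeping)] -/
theorem tendsto_weight_zero_of_relWeightBound (hW : RelWeightBound l₀ T A B Bad W) : Filter.Tendsto W Filter.atTop (nhds 0) :=
  hW.summable.tendsto_atTop_zero

end Guard

section Abstract

variable {κ : Type*} [DecidableEq κ] {σA σB : ℕ → Type*} [∀ K, Fintype (σA K)] [∀ K, Fintype (σB K)]

/-- Over an INJECTIVE key map the keyed fibre of `kA K s` is `{s}`: the fibre sum of any weight is the term weight.  (B §1 `sum_filter_sigma_twoRunKeyA_eq`'s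
abstract form.) [cite: Balaban1988Convergent, (2.18) p.257 (bookkeeping)] -/
theorem sum_filter_key_eq_of_injective {kA : (K : ℕ) → σA K → κ} (hinj : ∀ K, Function.Injective (kA K)) (K : ℕ) {β : Type*} [AddCommMonoid β]
    (f : σA K → β) (s : σA K) :
    ∑ s₁ ∈ Finset.univ.filter (fun s₁ => kA K s₁ = kA K s), f s₁ = f s := by
  have hfilter : Finset.univ.filter (fun s₁ => kA K s₁ = kA K s) = {s} := by
    ext s₁
    simp only [Finset.mem_filter, Finset.mem_univ, true_and, Finset.mem_singleton, (hinj K).eq_iff]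
  rw [hfilter, Finset.sum_singleton]

/-- Every class of the two-source class set `univ.image (kA K) ∪ univ.image (kB K)` is a run-A key when every run-B key has a run-A partner
(`range (kB K) ⊆ range (kA K)`). [cite: Balaban1988Convergent, (2.18) p.257 (bookkeeping)] -/
theorem exists_eq_keyA_of_mem_union {kA : (K : ℕ) → σA K → κ} {kB : (K : ℕ) → σB K → κ}
    (hrange : ∀ K, Set.range (kB K) ⊆ Set.range (kA K)) {K : ℕ} {x : κ}
    (hx : x ∈ Finset.univ.image (kA K) ∪ Finset.univ.image (kB K)) : ∃ s, kA K s = x := by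
  rcases Finset.mem_union.mp hx with h | h
  · obtain ⟨s, -, rfl⟩ := Finset.mem_image.mp h
    exact ⟨s, rfl⟩
  · obtain ⟨s', -, rfl⟩ := Finset.mem_image.mp h
    obtain ⟨s, hs⟩ := hrange K ⟨s', rfl⟩
    exact ⟨s, hs⟩

/-- **★ `NE7.Core` ON KEYED TWO-SOURCE FIBRE SUMS ⟺ A TERMWISE SANDWICH ON THE GOOD SOURCE TERMS — LOSS-FREE.**  Keyed data: class set
`T K := univ.image (kA K) ∪ univ.image (kB K)`, run A's keyed core `x ↦ (Σ_{s : kA K s = x} a K t s) − shA K t x`, run B's `x ↦ (Σ_{s' : kB K s' = x} b K t s') − shB K t x`,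
ANY bad key class `Bad`.  If `kA K` is injective (a run-A class is ONE term) and `range (kB K) ⊆ range (kA K)` (every run-B class has a run-A partner), then
`NE7.Core l₀ vol T Bad P Q δ` — for every `K` ONE constant `c` with `e^{c − vol·δ K}·P ≤ Q ≤ e^{c + vol·δ K}·P` on every good class, `|t| ≤ l₀` — holds IFF for every `K`
there is ONE `c` such that for every `|t| ≤ l₀` and every run-A source term `s` whose key is NOT bad,
`e^{c − vol·δ K}·(a K t s − shA K t (kA K s)) ≤ (Σ_{s' : kB K s' = kA K s} b K t s') − shB K t (kA K s) ≤ e^{c + vol·δ K}·(a K t s − shA K t (kA K s))`.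
The displayed right-hand side, for Bałaban's class weights, is N19's NE7 core content — NOT PRINTED, NOT proved, a hypothesis shape.
[cite: King1986, (3.10) p.656; Balaban1988Convergent, (2.18) p.257 (bookkeeping)] -/
theorem core_keyed_iff_termwise {l₀ vol : ℝ} (kA : (K : ℕ) → σA K → κ) (kB : (K : ℕ) → σB K → κ)
    (hinj : ∀ K, Function.Injective (kA K)) (hrange : ∀ K, Set.range (kB K) ⊆ Set.range (kA K))
    (a : (K : ℕ) → ℝ → σA K → ℝ) (b : (K : ℕ) → ℝ → σB K → ℝ) (shA shB : ℕ → ℝ → κ → ℝ) (Bad : ℕ → ℝ → Finset κ) (δ : ℕ → ℝ) :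
    NE7.Core l₀ vol (fun K => Finset.univ.image (kA K) ∪ Finset.univ.image (kB K)) Bad
        (fun K t x => (∑ s ∈ Finset.univ.filter (fun s => kA K s = x), a K t s) - shA K t x)
        (fun K t x => (∑ s' ∈ Finset.univ.filter (fun s' => kB K s' = x), b K t s') - shB K t x) δ
      ↔ ∀ K : ℕ, ∃ c : ℝ, ∀ t : ℝ, |t| ≤ l₀ → ∀ s : σA K, kA K s ∉ Bad K t →
          Real.exp (c - vol * δ K) * (a K t s - shA K t (kA K s))
              ≤ (∑ s' ∈ Finset.univ.filter (fun s' => kB K s' = kA K s), b K t s') - shB K t (kA K s) ∧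
            (∑ s' ∈ Finset.univ.filter (fun s' => kB K s' = kA K s), b K t s') - shB K t (kA K s)
              ≤ Real.exp (c + vol * δ K) * (a K t s - shA K t (kA K s)) := by
  constructor
  · intro h K
    obtain ⟨c, hc⟩ := h K
    refine ⟨c, fun t ht s hs => ?_⟩
    have hmem : kA K s ∈ (Finset.univ.image (kA K) ∪ Finset.univ.image (kB K)) \ Bad K t :=
      Finset.mem_sdiff.mpr ⟨Finset.mem_union_left _ (Finset.mem_image_of_mem _ (Finset.mem_univ s)), hs⟩
    have h' := hc t ht (kA K s) hmem
    simp only [sum_filter_key_eq_of_injective hinj K (a K t) s] at h'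
    exact h'
  · intro h K
    obtain ⟨c, hc⟩ := h K
    refine ⟨c, fun t ht x hx => ?_⟩
    obtain ⟨hxT, hxB⟩ := Finset.mem_sdiff.mp hx
    obtain ⟨s, rfl⟩ := exists_eq_keyA_of_mem_union hrange hxT
    have h' := hc t ht s hxB
    simp only [sum_filter_key_eq_of_injective hinj K (a K t) s]
    exact h'

/-- **`hedge`'s ∃-SHAPE FROM THE TERMWISE SANDWICH** (abstract keys): the sandwich of `core_keyed_iff_termwise` with a SUMMABLE remainder `δ` gives
`∃ δ, NE7.Core … δ ∧ Summable δ` on the keyed data. [cite: King1986, (3.10) p.656; Balaban1988Convergent, (2.18) p.257 (bookkeeping)] -/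
theorem coreEdge_keyed_of_termwise {l₀ vol : ℝ} (kA : (K : ℕ) → σA K → κ) (kB : (K : ℕ) → σB K → κ)
    (hinj : ∀ K, Function.Injective (kA K)) (hrange : ∀ K, Set.range (kB K) ⊆ Set.range (kA K))
    (a : (K : ℕ) → ℝ → σA K → ℝ) (b : (K : ℕ) → ℝ → σB K → ℝ) (shA shB : ℕ → ℝ → κ → ℝ) (Bad : ℕ → ℝ → Finset κ) {δ : ℕ → ℝ}
    (hδ : Summable δ)
    (hterm : ∀ K : ℕ, ∃ c : ℝ, ∀ t : ℝ, |t| ≤ l₀ → ∀ s : σA K, kA K s ∉ Bad K t →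
      Real.exp (c - vol * δ K) * (a K t s - shA K t (kA K s))
          ≤ (∑ s' ∈ Finset.univ.filter (fun s' => kB K s' = kA K s), b K t s') - shB K t (kA K s) ∧
        (∑ s' ∈ Finset.univ.filter (fun s' => kB K s' = kA K s), b K t s') - shB K t (kA K s)
          ≤ Real.exp (c + vol * δ K) * (a K t s - shA K t (kA K s))) :
    ∃ δ : ℕ → ℝ, NE7.Core l₀ vol (fun K => Finset.univ.image (kA K) ∪ Finset.univ.image (kB K)) Bad
        (fun K t x => (∑ s ∈ Finset.univ.filter (fun s => kA K s = x), a K t s) - shA K t x)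
        (fun K t x => (∑ s' ∈ Finset.univ.filter (fun s' => kB K s' = x), b K t s') - shB K t x) δ ∧ Summable δ :=
  ⟨δ, (core_keyed_iff_termwise kA kB hinj hrange a b shA shB Bad δ).2 hterm, hδ⟩

/-- The trivially INHABITED instance of the abstract face (shape sanity, not Bałaban's objects): if run B's keyed fibre core EQUALS run A's keyed term core on
every good key, the sandwich holds with `c = 0`, `δ = 0`. [cite: King1986, (3.10) p.656 (bookkeeping)] -/
theorem core_keyed_of_fibre_eq {l₀ vol : ℝ} (kA : (K : ℕ) → σA K → κ) (kB : (K : ℕ) → σB K → κ)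
    (hinj : ∀ K, Function.Injective (kA K)) (hrange : ∀ K, Set.range (kB K) ⊆ Set.range (kA K))
    (a : (K : ℕ) → ℝ → σA K → ℝ) (b : (K : ℕ) → ℝ → σB K → ℝ) (shA shB : ℕ → ℝ → κ → ℝ) (Bad : ℕ → ℝ → Finset κ)
    (heq : ∀ (K : ℕ) (t : ℝ), |t| ≤ l₀ → ∀ s : σA K, kA K s ∉ Bad K t →
      (∑ s' ∈ Finset.univ.filter (fun s' => kB K s' = kA K s), b K t s') - shB K t (kA K s) = a K t s - shA K t (kA K s)) :
    NE7.Core l₀ vol (fun K => Finset.univ.image (kA K) ∪ Finset.univ.image (kB K)) Bad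
        (fun K t x => (∑ s ∈ Finset.univ.filter (fun s => kA K s = x), a K t s) - shA K t x)
        (fun K t x => (∑ s' ∈ Finset.univ.filter (fun s' => kB K s' = x), b K t s') - shB K t x) (fun _ => 0) := by
  refine (core_keyed_iff_termwise kA kB hinj hrange a b shA shB Bad _).2 fun K => ⟨0, fun t ht s hs => ?_⟩
  rw [heq K t ht s hs]
  simp

end Abstract

/-! ## §2 AT NODE U5d's σ-PACKED TWO-RUN SITE KEYS under `RAgree` (option (c)): run B's keyed class over `kA s` is the `truncSeq`-fibre of `s` -/

section TwoRun

variable (F : T4Family) (ν : Stage7Numerics) (K₀ : ℕ) {M : ℕ} (hM : 0 < M) {gA gB : ℕ → ℕ → ℝ}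

/-- Under `RAgree` every run-B σ-key has a run-A partner: `range kB ⊆ range kA` for the σ-packed keys (`twoRunKeyB_eq_twoRunKeyA_truncSeq`).
[cite: Balaban1988Convergent, (2.5) p.255, (2.18) p.257 (bookkeeping)] -/
theorem range_sigma_twoRunKeyB_subset_of_rAgree {K : ℕ} (hR : RAgree F ν (gA K) (gB K) (K₀ + K)) :
    Set.range (fun s' : SeqOfRecord F ν M (gB K) (K₀ + K + 1) (K₀ + K + 1) =>
        (⟨K, twoRunKeyB F ν hM (gB K) (K₀ + K) (K₀ + K) s'⟩ : Σ K, SiteSeqKey F (K₀ + K)))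
      ⊆ Set.range (fun s : SeqOfRecord F ν M (gA K) (K₀ + K) (K₀ + K) =>
        (⟨K, twoRunKeyA F ν M (gA K) (K₀ + K) (K₀ + K) s⟩ : Σ K, SiteSeqKey F (K₀ + K))) := by
  rintro _ ⟨s', rfl⟩
  refine ⟨truncSeq F ν hM hR s', ?_⟩
  show (⟨K, twoRunKeyA F ν M (gA K) (K₀ + K) (K₀ + K) (truncSeq F ν hM hR s')⟩ : Σ K, SiteSeqKey F (K₀ + K))
      = ⟨K, twoRunKeyB F ν hM (gB K) (K₀ + K) (K₀ + K) s'⟩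
  rw [twoRunKeyB_eq_twoRunKeyA_truncSeq F ν hM hR s']

variable [∀ Kc, DecidableEq (SiteSeqKey F Kc)]

open Classical in
/-- **★★ N19's CORE EDGE AT NODE U5d's σ-PACKED TWO-RUN SITE KEYS IS A TERMWISE SANDWICH OF RUN A's (2.18) TERMS AGAINST RUN B's BLOCK-DOWN FIBRES —
LOSS-FREE, FOR ANY BAD KEY CLASS.**  Keyed data EXACTLY as at B :169 (class set `univ.image (kA K) ∪ univ.image (kB K)`, `kA K s = ⟨K, twoRunKeyA … s⟩`,
`kB K s' = ⟨K, twoRunKeyB … s'⟩`, cores `keyed fibre sum − shell`), weights `a K t` on run A's sequences at cutoff `K₀ + K` and `b K t` on run B's at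
`K₀ + K + 1` GENERIC, shells `shA shB` and `Bad` GENERIC; flow hypothesis `hR` DISPLAYED.  Then `NE7.Core l₀ vol T Bad (A − shA) (B − shB) δ` IFF for every `K`
ONE constant `c` such that for every `|t| ≤ l₀` and every run-A sequence `s` with `⟨K, kA s⟩ ∉ Bad K t`:
`e^{c − vol·δ K}·(a K t s − shA K t ⟨K, kA s⟩) ≤ (Σ_{s' : truncSeq s' = s} b K t s') − shB K t ⟨K, kA s⟩ ≤ e^{c + vol·δ K}·(a K t s − shA K t ⟨K, kA s⟩)` — run B summed
over the (2.18) terms at the finer cutoff that block down to `s` (node U5d's partial summation; B §1 `sum_filter_sigma_twoRunKeyB_keyA_eq_sum_filter_truncSeq`).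
[cite: King1986, (3.10) p.656; Balaban1988Convergent, (2.1) p.254, (2.5) p.255, (2.18) p.257; Balaban1989LargeFieldII, Thm 1 + (0.1) pp.355–356 (bookkeeping)] -/
theorem core_twoRunKeyed_iff_termwise (hR : ∀ K, RAgree F ν (gA K) (gB K) (K₀ + K)) {l₀ vol : ℝ}
    (a : (K : ℕ) → ℝ → SeqOfRecord F ν M (gA K) (K₀ + K) (K₀ + K) → ℝ) (b : (K : ℕ) → ℝ → SeqOfRecord F ν M (gB K) (K₀ + K + 1) (K₀ + K + 1) → ℝ)
    (shA shB : ℕ → ℝ → (Σ K, SiteSeqKey F (K₀ + K)) → ℝ) (Bad : ℕ → ℝ → Finset (Σ K, SiteSeqKey F (K₀ + K))) (δ : ℕ → ℝ) :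
    NE7.Core l₀ vol
        (fun K => Finset.univ.image (fun s : SeqOfRecord F ν M (gA K) (K₀ + K) (K₀ + K) =>
            (⟨K, twoRunKeyA F ν M (gA K) (K₀ + K) (K₀ + K) s⟩ : Σ K, SiteSeqKey F (K₀ + K)))
          ∪ Finset.univ.image (fun s' : SeqOfRecord F ν M (gB K) (K₀ + K + 1) (K₀ + K + 1) =>
            (⟨K, twoRunKeyB F ν hM (gB K) (K₀ + K) (K₀ + K) s'⟩ : Σ K, SiteSeqKey F (K₀ + K))))
        Bad
        (fun K t x => (∑ s ∈ Finset.univ.filter (fun s : SeqOfRecord F ν M (gA K) (K₀ + K) (K₀ + K) =>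
            (⟨K, twoRunKeyA F ν M (gA K) (K₀ + K) (K₀ + K) s⟩ : Σ K, SiteSeqKey F (K₀ + K)) = x), a K t s) - shA K t x)
        (fun K t x => (∑ s' ∈ Finset.univ.filter (fun s' : SeqOfRecord F ν M (gB K) (K₀ + K + 1) (K₀ + K + 1) =>
            (⟨K, twoRunKeyB F ν hM (gB K) (K₀ + K) (K₀ + K) s'⟩ : Σ K, SiteSeqKey F (K₀ + K)) = x), b K t s') - shB K t x) δ
      ↔ ∀ K : ℕ, ∃ c : ℝ, ∀ t : ℝ, |t| ≤ l₀ → ∀ s : SeqOfRecord F ν M (gA K) (K₀ + K) (K₀ + K),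
          (⟨K, twoRunKeyA F ν M (gA K) (K₀ + K) (K₀ + K) s⟩ : Σ K, SiteSeqKey F (K₀ + K)) ∉ Bad K t →
          Real.exp (c - vol * δ K) * (a K t s - shA K t ⟨K, twoRunKeyA F ν M (gA K) (K₀ + K) (K₀ + K) s⟩)
              ≤ (∑ s' ∈ Finset.univ.filter (fun s' : SeqOfRecord F ν M (gB K) (K₀ + K + 1) (K₀ + K + 1) => truncSeq F ν hM (hR K) s' = s), b K t s')
                  - shB K t ⟨K, twoRunKeyA F ν M (gA K) (K₀ + K) (K₀ + K) s⟩ ∧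
            (∑ s' ∈ Finset.univ.filter (fun s' : SeqOfRecord F ν M (gB K) (K₀ + K + 1) (K₀ + K + 1) => truncSeq F ν hM (hR K) s' = s), b K t s')
                  - shB K t ⟨K, twoRunKeyA F ν M (gA K) (K₀ + K) (K₀ + K) s⟩
              ≤ Real.exp (c + vol * δ K) * (a K t s - shA K t ⟨K, twoRunKeyA F ν M (gA K) (K₀ + K) (K₀ + K) s⟩) := by
  rw [core_keyed_iff_termwise
    (fun K (s : SeqOfRecord F ν M (gA K) (K₀ + K) (K₀ + K)) => (⟨K, twoRunKeyA F ν M (gA K) (K₀ + K) (K₀ + K) s⟩ : Σ K, SiteSeqKey F (K₀ + K)))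
    (fun K (s' : SeqOfRecord F ν M (gB K) (K₀ + K + 1) (K₀ + K + 1)) => (⟨K, twoRunKeyB F ν hM (gB K) (K₀ + K) (K₀ + K) s'⟩ : Σ K, SiteSeqKey F (K₀ + K)))
    (fun K => sigma_twoRunKeyA_injective F ν K₀ M gA K) (fun K => range_sigma_twoRunKeyB_subset_of_rAgree F ν K₀ hM (hR K)) a b shA shB Bad δ]
  refine forall_congr' fun K => exists_congr fun c => forall_congr' fun t => forall_congr' fun _ => forall_congr' fun s => forall_congr' fun _ => ?_
  rw [sum_filter_sigma_twoRunKeyB_keyA_eq_sum_filter_truncSeq F ν K₀ hM (hR K) (b K t) s]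

open Classical in
/-- **★★ THE `hedge` BINDER OF B :169 FROM THE TERMWISE SANDWICH** at node U5d's σ-packed two-run site keys: the sandwich of `core_twoRunKeyed_iff_termwise`
with a SUMMABLE remainder `δ` gives `∃ δ, NE7.Core l₀ vol T Bad (A − shA) (B − shB) δ ∧ Summable δ` VERBATIM in B's shape (weights, shells and `Bad` generic —
instantiate `a K t := classWeightOfDatum₉ … ⟨K₀ + K, mA K, cA K⟩ (gA K) (K₀ + K) t`, `b K t := … ⟨K₀ + K + 1, mB K, cB K⟩ (gB K) (K₀ + K + 1) t` for B §2).
DISPLAYED: `hR`, `hδ`, the termwise sandwich — nothing else. [cite: King1986, (3.10) p.656; Balaban1988Convergent, (2.18) p.257; Balaban1989LargeFieldII, Thm 1 + (0.1) pp.355–356 (bookkeeping)] -/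
theorem coreEdge_twoRunKeyed_of_termwise (hR : ∀ K, RAgree F ν (gA K) (gB K) (K₀ + K)) {l₀ vol : ℝ}
    (a : (K : ℕ) → ℝ → SeqOfRecord F ν M (gA K) (K₀ + K) (K₀ + K) → ℝ) (b : (K : ℕ) → ℝ → SeqOfRecord F ν M (gB K) (K₀ + K + 1) (K₀ + K + 1) → ℝ)
    (shA shB : ℕ → ℝ → (Σ K, SiteSeqKey F (K₀ + K)) → ℝ) (Bad : ℕ → ℝ → Finset (Σ K, SiteSeqKey F (K₀ + K))) {δ : ℕ → ℝ} (hδ : Summable δ)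
    (hterm : ∀ K : ℕ, ∃ c : ℝ, ∀ t : ℝ, |t| ≤ l₀ → ∀ s : SeqOfRecord F ν M (gA K) (K₀ + K) (K₀ + K),
      (⟨K, twoRunKeyA F ν M (gA K) (K₀ + K) (K₀ + K) s⟩ : Σ K, SiteSeqKey F (K₀ + K)) ∉ Bad K t →
      Real.exp (c - vol * δ K) * (a K t s - shA K t ⟨K, twoRunKeyA F ν M (gA K) (K₀ + K) (K₀ + K) s⟩)
          ≤ (∑ s' ∈ Finset.univ.filter (fun s' : SeqOfRecord F ν M (gB K) (K₀ + K + 1) (K₀ + K + 1) => truncSeq F ν hM (hR K) s' = s), b K t s')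
              - shB K t ⟨K, twoRunKeyA F ν M (gA K) (K₀ + K) (K₀ + K) s⟩ ∧
        (∑ s' ∈ Finset.univ.filter (fun s' : SeqOfRecord F ν M (gB K) (K₀ + K + 1) (K₀ + K + 1) => truncSeq F ν hM (hR K) s' = s), b K t s')
              - shB K t ⟨K, twoRunKeyA F ν M (gA K) (K₀ + K) (K₀ + K) s⟩
          ≤ Real.exp (c + vol * δ K) * (a K t s - shA K t ⟨K, twoRunKeyA F ν M (gA K) (K₀ + K) (K₀ + K) s⟩)) :
    ∃ δ : ℕ → ℝ, NE7.Core l₀ vol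
        (fun K => Finset.univ.image (fun s : SeqOfRecord F ν M (gA K) (K₀ + K) (K₀ + K) =>
            (⟨K, twoRunKeyA F ν M (gA K) (K₀ + K) (K₀ + K) s⟩ : Σ K, SiteSeqKey F (K₀ + K)))
          ∪ Finset.univ.image (fun s' : SeqOfRecord F ν M (gB K) (K₀ + K + 1) (K₀ + K + 1) =>
            (⟨K, twoRunKeyB F ν hM (gB K) (K₀ + K) (K₀ + K) s'⟩ : Σ K, SiteSeqKey F (K₀ + K))))
        Bad
        (fun K t x => (∑ s ∈ Finset.univ.filter (fun s : SeqOfRecord F ν M (gA K) (K₀ + K) (K₀ + K) =>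
            (⟨K, twoRunKeyA F ν M (gA K) (K₀ + K) (K₀ + K) s⟩ : Σ K, SiteSeqKey F (K₀ + K)) = x), a K t s) - shA K t x)
        (fun K t x => (∑ s' ∈ Finset.univ.filter (fun s' : SeqOfRecord F ν M (gB K) (K₀ + K + 1) (K₀ + K + 1) =>
            (⟨K, twoRunKeyB F ν hM (gB K) (K₀ + K) (K₀ + K) s'⟩ : Σ K, SiteSeqKey F (K₀ + K)) = x), b K t s') - shB K t x) δ ∧ Summable δ :=
  ⟨δ, (core_twoRunKeyed_iff_termwise F ν K₀ hM hR a b shA shB Bad δ).2 hterm, hδ⟩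

open Classical in
/-- **THE DEGENERATE SPLIT `Bad := ∅`** (the tree's `relWeightBound_empty` instance of `h20`, `W := 0`): with NO bad key class N19's core edge at the σ-packed two-run keys
IS the termwise sandwich on EVERY run-A (2.18) sequence — old large fields included — against run B's `truncSeq`-fibres: NE7 proper with no weight bound (the
reading under which NE7b is not needed at this index; cf. the LOCATED note of this seat on the pub-ymgap bus on the (2.18) chain being antitone).
[cite: King1986, (3.10) p.656; Balaban1988Convergent, (2.1) p.254, (2.18) p.257 (bookkeeping)] -/
theorem core_twoRunKeyed_bad_empty_iff_termwise (hR : ∀ K, RAgree F ν (gA K) (gB K) (K₀ + K)) {l₀ vol : ℝ}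
    (a : (K : ℕ) → ℝ → SeqOfRecord F ν M (gA K) (K₀ + K) (K₀ + K) → ℝ) (b : (K : ℕ) → ℝ → SeqOfRecord F ν M (gB K) (K₀ + K + 1) (K₀ + K + 1) → ℝ)
    (shA shB : ℕ → ℝ → (Σ K, SiteSeqKey F (K₀ + K)) → ℝ) (δ : ℕ → ℝ) :
    NE7.Core l₀ vol
        (fun K => Finset.univ.image (fun s : SeqOfRecord F ν M (gA K) (K₀ + K) (K₀ + K) =>
            (⟨K, twoRunKeyA F ν M (gA K) (K₀ + K) (K₀ + K) s⟩ : Σ K, SiteSeqKey F (K₀ + K)))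
          ∪ Finset.univ.image (fun s' : SeqOfRecord F ν M (gB K) (K₀ + K + 1) (K₀ + K + 1) =>
            (⟨K, twoRunKeyB F ν hM (gB K) (K₀ + K) (K₀ + K) s'⟩ : Σ K, SiteSeqKey F (K₀ + K))))
        (fun _ _ => ∅)
        (fun K t x => (∑ s ∈ Finset.univ.filter (fun s : SeqOfRecord F ν M (gA K) (K₀ + K) (K₀ + K) =>
            (⟨K, twoRunKeyA F ν M (gA K) (K₀ + K) (K₀ + K) s⟩ : Σ K, SiteSeqKey F (K₀ + K)) = x), a K t s) - shA K t x)
        (fun K t x => (∑ s' ∈ Finset.univ.filter (fun s' : SeqOfRecord F ν M (gB K) (K₀ + K + 1) (K₀ + K + 1) =>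
            (⟨K, twoRunKeyB F ν hM (gB K) (K₀ + K) (K₀ + K) s'⟩ : Σ K, SiteSeqKey F (K₀ + K)) = x), b K t s') - shB K t x) δ
      ↔ ∀ K : ℕ, ∃ c : ℝ, ∀ t : ℝ, |t| ≤ l₀ → ∀ s : SeqOfRecord F ν M (gA K) (K₀ + K) (K₀ + K),
          Real.exp (c - vol * δ K) * (a K t s - shA K t ⟨K, twoRunKeyA F ν M (gA K) (K₀ + K) (K₀ + K) s⟩)
              ≤ (∑ s' ∈ Finset.univ.filter (fun s' : SeqOfRecord F ν M (gB K) (K₀ + K + 1) (K₀ + K + 1) => truncSeq F ν hM (hR K) s' = s), b K t s')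
                  - shB K t ⟨K, twoRunKeyA F ν M (gA K) (K₀ + K) (K₀ + K) s⟩ ∧
            (∑ s' ∈ Finset.univ.filter (fun s' : SeqOfRecord F ν M (gB K) (K₀ + K + 1) (K₀ + K + 1) => truncSeq F ν hM (hR K) s' = s), b K t s')
                  - shB K t ⟨K, twoRunKeyA F ν M (gA K) (K₀ + K) (K₀ + K) s⟩
              ≤ Real.exp (c + vol * δ K) * (a K t s - shA K t ⟨K, twoRunKeyA F ν M (gA K) (K₀ + K) (K₀ + K) s⟩) := by
  rw [core_twoRunKeyed_iff_termwise F ν K₀ hM hR a b shA shB _ δ]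
  refine forall_congr' fun K => exists_congr fun c => forall_congr' fun t => forall_congr' fun _ => forall_congr' fun s => ?_
  simp only [Finset.notMem_empty, not_false_eq_true, forall_const]

end TwoRun

end Summit.QuantumFields.YangMills.BalabanUVNodes.N20CoreEdgeTwoRunKeyed

end
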